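import Literature.Probability.LatticeModels.RotatedTorusDiagonalFourier
import Literature.Probability.LatticeModels.SubcriticalFourier
import HarnessLib

/-!
# ADC Prop. 5.4 (iii) in infinite volume: the limit of the diagonal Fourier modes of the rotated torus

Topic `Literature/Probability/LatticeModels`; family `crit-ising`. No named fact, no sorry. Definitions:
the diagonal lattice map `diagMap` (`L(y) = (y₀−y₁, y₀+y₁, y₂, …)`, a bijection of `ℤ^{d''+2}` onto the
even sublattice), its dual `diagMomentum` (`M(p)·L(y) = p·y`), the finite-volume real diagonal Fourier
sum `rotDiagSum`, its limit `twoPointPlusFourierDiag` (`T_β(p) = ∑_y ⟨σ₀σ_{L y}⟩⁺_β cos(p·y)`), and the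
diagonal momentum shift `piDiag = π(1,1,0,…)`.

## What is proved (`0 ≤ β < β_c(d''+2)`, nearest-neighbour Ising model on `ℤ^{d''+2}`)

* `tendsto_rotDiagSum` — the diagonal Fourier modes of the rotated tori of `RotatedTorus*` converge:
  `Σ_{N_j}(k̂_j) → T_β(p)` whenever `2πk̂_j/N_j → p` (dominated convergence over `ℤ^{d''+2}` in the
  diagonal coordinates `y`: pointwise convergence from the Griffiths sandwich of `RotatedTorus`, and
  the uniform decay on the diagonal representative domain `|x₀+x₁|, |x₁−x₀| ≤ N`, `2|x_j| ≤ N`,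
  `exists_uniform_decay_rotTwoPoint_diag`, from the structure of `Γ_rot`);
* `two_mul_twoPointPlusFourierDiag_eq` — `2T_β(p) = Ŝ_β(Mp) + Ŝ_β(Mp + π(1,1,0,…)) = Ŝ^{mod}_β(Mp)`;
* `twoPointPlusFourierDiag_update_le_of_cos_lt` — **ADC Prop. 5.4 (iii)**: `T_β(P', p₁, …) ≤ T_β(p)`
  for `cos P' < cos p₀`, i.e. `Ŝ^{mod}_β` decreases in the diagonal frequency `r₀ + r₁` at fixed
  `r₁ − r₀`; and, through the symmetry `T(P,Q,·) = T(−Q,−P,·)` (`twoPointPlusFourierDiag_swap_neg`,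
  from the evenness of `Ŝ`), `twoPointPlusFourierDiag_update_one_le_of_cos_lt` — the printed form,
  decreasing in `|r₁ − r₀|` at fixed `r₀ + r₁`;
* `twoPointPlusFourier_mod_merge_le`, `twoPointPlusFourier_merge_le` — the consequence used in the
  proof of ADC Thm 5.6 (via Cor. 5.5): `Ŝ_β(r₀+r₁, 0, r₂, …) ≤ Ŝ_β(r) + 1/(4β)` for
  `0 ≤ r₀, r₁ ≤ π/2`, `0 < β < β_c` (with `Ŝ ≥ 0` and the infrared bound of `SubcriticalFourier`);
* `twoPointPlusFourier_comp_perm` — `Ŝ_β(p ∘ π) = Ŝ_β(p)` for coordinate permutations.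

The strict hypothesis `cos P' < cos p₀` suffices downstream; the boundary case follows from the
symmetries but is not needed. Step V4c of the tree's programme towards ADC Thm 5.6
(`aizenmanDuminilCopin_slidingScaleInfraredBound`).

## References

* M. Aizenman, H. Duminil-Copin, Ann. of Math. 194 (2021) = arXiv:1912.07973, Prop. 5.2, Prop. 5.4
  (iii), Cor. 5.5 (p. 17–19) [AizenmanDuminilCopinAnnals2021]; R. Panis, arXiv:2309.05797, Prop. 3.16
  [Panis2023Triviality].
* H. Duminil-Copin, V. Tassion, Comm. Math. Phys. 343 (2016), §2.5 [DuminilCopinTassionCMP2016].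
* S. Friedli, Y. Velenik (2017), Exercise 3.14 [FriedliVelenik2017].

## Mathlib

`tendsto_tsum_of_dominated_convergence`, `Function.Injective.tsum_eq`, `Summable.comp_injective`,
`Real.cos_add_int_mul_pi`, `Even.neg_one_zpow`, `Real.cos_lt_cos_of_nonneg_of_le_pi`, `Fin.consEquiv`.
-/

noncomputable section

open MeasureTheory Filter Topology Finset Complex
open scoped ComplexConjugate

namespace Literature.Probability.LatticeModels

/-! ### Part 1. Uniform decay on the diagonal representative domain -/

section DiagDecay

variable {d'' : ℕ} {N : ℕ}

/-- **Structure of `Γ_rot` on the diagonal representative domain**: if `γ̄ = 0`, `γ ≠ 0`, and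
`|x₀ + x₁| ≤ N`, `|x₁ - x₀| ≤ N`, `2|x_j| ≤ N` (`j ≥ 2`), then `x + γ` has a coordinate of absolute
value `≥ N/2`. (Write `γ₁ = Nj`, `γ₀ + γ₁ = 2Nl`: if `l ≠ 0` the sum `x₀+x₁` moves by `≥ 2N`; if
`l = 0 ≠ j` the difference `x₁−x₀` moves by `≥ 2N`; otherwise some `γ_j`, `j ≥ 2`, is a nonzero
multiple of `N`.) [folklore] -/
theorem exists_two_mul_abs_add_ge_diag {γ x : Site (d'' + 2)} (hγ : rotProj d'' N γ = 0) (hγ0 : γ ≠ 0)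
    (hs : |x 0 + x 1| ≤ N) (hd : |x 1 - x 0| ≤ N) (hz : ∀ j : Fin d'', 2 * |x j.succ.succ| ≤ N) :
    ∃ j, (N : ℤ) ≤ 2 * |(x + γ) j| := by
  have hdiv : ∀ j : Fin (d'' + 1), (N : ℤ) ∣ γ j.succ := fun j => by
    have : ((γ j.succ : ℤ) : ZMod N) = 0 := by
      have := congrArg Prod.snd hγ
      simpa [rotProj_apply_snd] using congrFun this j
    exact (ZMod.intCast_zmod_eq_zero_iff_dvd _ _).1 this
  have h01 : (2 * N : ℤ) ∣ γ 0 + γ 1 := by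
    have : ((γ 0 + γ 1 : ℤ) : ZMod (2 * N)) = 0 := by
      have := congrArg Prod.fst hγ
      simpa [rotProj_apply_fst] using this
    rw [ZMod.intCast_zmod_eq_zero_iff_dvd] at this
    exact_mod_cast this
  obtain ⟨l, hl⟩ := h01
  obtain ⟨j₁, hj₁⟩ := hdiv 0
  have hγ1 : γ 1 = N * j₁ := hj₁
  by_cases hl0 : l ≠ 0
  · -- the sum moves by `2N l`
    have h1 : (1 : ℤ) ≤ |l| := Int.one_le_abs hl0
    have hsum : (x + γ) 0 + (x + γ) 1 = (x 0 + x 1) + 2 * N * l := by simp only [Pi.add_apply]; linarith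
    have hbig : (N : ℤ) ≤ |(x + γ) 0 + (x + γ) 1| := by
      rw [hsum]
      have h2 : |2 * (N : ℤ) * l| = 2 * N * |l| := by rw [abs_mul, abs_of_nonneg (by positivity)]
      have h3 := abs_sub_abs_le_abs_sub (2 * (N : ℤ) * l) (-(x 0 + x 1))
      rw [sub_neg_eq_add, abs_neg] at h3
      have h4 : |x 0 + x 1 + 2 * N * l| = |2 * (N : ℤ) * l + (x 0 + x 1)| := by rw [add_comm (x 0 + x 1)]
      have h5 : (2 * N : ℤ) * 1 ≤ 2 * N * |l| := mul_le_mul_of_nonneg_left h1 (by positivity)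
      rw [h4]
      linarith
    have htri : |(x + γ) 0 + (x + γ) 1| ≤ |(x + γ) 0| + |(x + γ) 1| := abs_add_le _ _
    rcases le_or_gt |(x + γ) 1| |(x + γ) 0| with h | h
    · exact ⟨0, by linarith⟩
    · exact ⟨1, by linarith⟩
  · push Not at hl0
    subst hl0
    have h0 : γ 0 = -γ 1 := by linarith
    by_cases hj0 : j₁ ≠ 0
    · -- the difference moves by `2N j₁`
      have h1 : (1 : ℤ) ≤ |j₁| := Int.one_le_abs hj0
      have hdiff : (x + γ) 1 - (x + γ) 0 = (x 1 - x 0) + 2 * N * j₁ := by simp only [Pi.add_apply]; rw [h0, hγ1]; ring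
      have hbig : (N : ℤ) ≤ |(x + γ) 1 - (x + γ) 0| := by
        rw [hdiff]
        have h2 : |2 * (N : ℤ) * j₁| = 2 * N * |j₁| := by rw [abs_mul, abs_of_nonneg (by positivity)]
        have h3 := abs_sub_abs_le_abs_sub (2 * (N : ℤ) * j₁) (-(x 1 - x 0))
        rw [sub_neg_eq_add, abs_neg] at h3
        have h4 : |x 1 - x 0 + 2 * N * j₁| = |2 * (N : ℤ) * j₁ + (x 1 - x 0)| := by rw [add_comm (x 1 - x 0)]
        have h5 : (2 * N : ℤ) * 1 ≤ 2 * N * |j₁| := mul_le_mul_of_nonneg_left h1 (by positivity)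
        rw [h4]
        linarith
      have htri : |(x + γ) 1 - (x + γ) 0| ≤ |(x + γ) 1| + |(x + γ) 0| := abs_sub _ _
      rcases le_or_gt |(x + γ) 1| |(x + γ) 0| with h | h
      · exact ⟨0, by linarith⟩
      · exact ⟨1, by linarith⟩
    · push Not at hj0
      subst hj0
      have hγ1' : γ 1 = 0 := by rw [hγ1]; ring
      have hγ0' : γ 0 = 0 := by rw [h0, hγ1', neg_zero]
      -- some `γ_{j+2} ≠ 0`
      have hrest : ∃ j : Fin d'', γ j.succ.succ ≠ 0 := by
        by_contra hcon
        push Not at hcon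
        apply hγ0
        funext i
        refine Fin.cases hγ0' (fun i' => Fin.cases hγ1' (fun j => hcon j) i') i
      obtain ⟨j, hj⟩ := hrest
      refine ⟨j.succ.succ, ?_⟩
      obtain ⟨c, hc⟩ := hdiv j.succ
      have hc0 : c ≠ 0 := by rintro rfl; exact hj (by simpa using hc)
      have hN : (N : ℤ) ≤ |γ j.succ.succ| := by
        rw [hc, abs_mul]
        have : (1 : ℤ) ≤ |c| := Int.one_le_abs hc0
        calc (N : ℤ) ≤ |(N : ℤ)| := le_abs_self _
          _ = |(N : ℤ)| * 1 := (mul_one _).symm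
          _ ≤ |(N : ℤ)| * |c| := mul_le_mul_of_nonneg_left this (abs_nonneg _)
      have htri : |γ j.succ.succ| ≤ |(x + γ) j.succ.succ| + |x j.succ.succ| := by
        have := abs_sub ((x + γ) j.succ.succ) (x j.succ.succ)
        simpa using this
      have := hz j
      linarith

variable [NeZero N]

/-- **The quotient norm on the diagonal representative domain**: `‖x‖_∞ ≤ 2|x̄|_rot` when
`|x₀ + x₁| ≤ N`, `|x₁ − x₀| ≤ N`, `2|x_j| ≤ N` (`j ≥ 2`). [folklore] -/
theorem supNorm_le_two_mul_rotNorm_diag {x : Site (d'' + 2)} (hs : |x 0 + x 1| ≤ N) (hd : |x 1 - x 0| ≤ N)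
    (hz : ∀ j : Fin d'', 2 * |x j.succ.succ| ≤ N) :
    Site.supNorm x ≤ 2 * rotNorm (rotProj d'' N x) := by
  obtain ⟨y, hy, hyle⟩ := exists_rep_rotNorm (rotProj d'' N x)
  have hγ : rotProj d'' N (y - x) = 0 := by rw [map_sub, hy, sub_self]
  have hsupx : Site.supNorm x ≤ N := by
    unfold Site.supNorm
    refine Finset.sup_le fun j _ => ?_
    have : ((x j).natAbs : ℤ) ≤ N := by
      rw [Int.natCast_natAbs]
      refine Fin.cases ?_ (fun i' => Fin.cases ?_ (fun j => ?_) i') j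
      · have h1 := abs_add_le (x 0 + x 1) (-(x 1 - x 0)); rw [abs_neg] at h1
        have : x 0 + x 1 + -(x 1 - x 0) = 2 * x 0 := by ring
        rw [this, abs_mul, abs_two] at h1
        linarith
      · have h1 := abs_add_le (x 0 + x 1) (x 1 - x 0)
        have : x 0 + x 1 + (x 1 - x 0) = 2 * x 1 := by ring
        rw [this, abs_mul, abs_two] at h1
        change |x 1| ≤ N
        linarith
      · have := hz j; linarith [abs_nonneg (x j.succ.succ)]
    exact_mod_cast this
  rcases eq_or_ne (y - x) 0 with h0 | h0
  · have : y = x := sub_eq_zero.1 h0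
    subst this
    omega
  · obtain ⟨j, hj⟩ := exists_two_mul_abs_add_ge_diag hγ h0 hs hd hz
    rw [add_sub_cancel] at hj
    have hyj : ((y j).natAbs : ℤ) ≤ Site.supNorm y := by exact_mod_cast Site.natAbs_le_supNorm y j
    rw [Int.natCast_natAbs] at hyj
    have : (Site.supNorm x : ℤ) ≤ 2 * Site.supNorm y := by
      have : (Site.supNorm x : ℤ) ≤ N := by exact_mod_cast hsupx
      linarith
    have : Site.supNorm x ≤ 2 * Site.supNorm y := by exact_mod_cast this
    omega

omit [NeZero N] in
/-- **Uniform exponential decay on the rotated tori below `β_c`, on the diagonal representative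
domain**: for `0 ≤ β < β_c(d''+2)` there are `R ≥ 1`, `θ ∈ [0,1)` with
`0 ≤ ⟨σ₀σ_{x̄}⟩^{rot}_{N;β} ≤ θ^{⌊‖x‖_∞/(4(R+1))⌋}` whenever `N ≥ 2R + 4`, `|x₀ + x₁| ≤ N`, `|x₁ − x₀| ≤ N` and
`2|x_j| ≤ N` (`j ≥ 2`). [cite: DuminilCopinTassionCMP2016, Thm. 2.1 (3), Lemma 2.7, §2.5] [cite: AizenmanDuminilCopinAnnals2021, arXiv:1912.07973 Prop. 5.2 (p. 17)] -/
theorem exists_uniform_decay_rotTwoPoint_diag {β : ℝ} (hβ : 0 ≤ β) (hβc : β < criticalBeta (d'' + 2)) :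
    ∃ (R : ℕ) (θ : ℝ), 1 ≤ R ∧ 0 ≤ θ ∧ θ < 1 ∧
      ∀ (N : ℕ) [NeZero N], 2 * R + 4 ≤ N → ∀ x : Site (d'' + 2), |x 0 + x 1| ≤ N → |x 1 - x 0| ≤ N →
        (∀ j : Fin d'', 2 * |x j.succ.succ| ≤ N) →
        0 ≤ rotTwoPoint d'' N β 0 (rotProj d'' N x) ∧
          rotTwoPoint d'' N β 0 (rotProj d'' N x) ≤ θ ^ (Site.supNorm x / (4 * (R + 1))) := by
  obtain ⟨R, hR1, hφ⟩ := exists_dctIsingPhi_box_lt_one_of_lt_criticalBeta (d := d'' + 2) (by omega) hβ hβc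
  have hφ0 : 0 ≤ dctIsingPhi (d'' + 2) β (box (d'' + 2) R) :=
    dctIsingPhi_nonneg (fun {_ _ _ _ _} => GriffithsKellySherman.gks_one_holds (zdGraph (d'' + 2))) hβ (zero_mem_box (d'' + 2) R)
  refine ⟨R, dctIsingPhi (d'' + 2) β (box (d'' + 2) R), hR1, hφ0, hφ, fun N _ hN x hs hd hz =>
    ⟨rotTwoPoint_nonneg hβ _ _, ?_⟩⟩
  refine (rotTwoPoint_le_dctIsingPhi_pow hβ hN _).trans (pow_le_pow_of_le_one hφ0 hφ.le ?_)
  have h := supNorm_le_two_mul_rotNorm_diag (d'' := d'') (N := N) hs hd hz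
  set r := rotNorm (rotProj d'' N x) with hr
  have hlt : r < (R + 1) * (r / (R + 1) + 1) := Nat.lt_mul_div_succ r (by omega)
  have : Site.supNorm x / (4 * (R + 1)) < r / (R + 1) + 1 := by
    rw [Nat.div_lt_iff_lt_mul (by positivity)]
    nlinarith
  omega

end DiagDecay

/-! ### Part 2. The diagonal change of variables `L(y) = (y₀ − y₁, y₀ + y₁, y₂, …)` -/

section DiagMap

variable {d'' : ℕ}

variable (d'') in
/-- The **diagonal lattice map** `L(y) = (y₀ − y₁, y₀ + y₁, y₂, …)`, a bijection of `ℤ^{d''+2}` onto the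
even sublattice `{x : x₀ + x₁ even}`; `y₀ = (x₀+x₁)/2` is the diagonal ("time") coordinate and
`y₁ = (x₁−x₀)/2` the anti-diagonal one. [cite: AizenmanDuminilCopinAnnals2021, arXiv:1912.07973 proof of Prop. 5.4 (iii) (coordinates `(x₁+x₂, x₁−x₂, x₃, …)`, p. 18)] -/
def diagMap (y : Site (d'' + 2)) : Site (d'' + 2) :=
  Fin.cons (y 0 - y 1) (Fin.cons (y 0 + y 1) (fun j => y j.succ.succ))

/-- `L(y)₀ = y₀ − y₁`. [folklore] -/
@[simp] theorem diagMap_zero (y : Site (d'' + 2)) : diagMap d'' y 0 = y 0 - y 1 := rfl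
/-- `L(y)₁ = y₀ + y₁`. [folklore] -/
@[simp] theorem diagMap_one (y : Site (d'' + 2)) : diagMap d'' y 1 = y 0 + y 1 := rfl
/-- `L(y)_{j+2} = y_{j+2}`. [folklore] -/
@[simp] theorem diagMap_succ_succ (y : Site (d'' + 2)) (j : Fin d'') : diagMap d'' y j.succ.succ = y j.succ.succ := rfl

/-- `L` is injective. [folklore] -/
theorem diagMap_injective : Function.Injective (diagMap d'') := by
  intro y y' h
  have h0 := congrFun h 0
  have h1 := congrFun h 1
  simp only [diagMap_zero, diagMap_one] at h0 h1
  funext i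
  refine Fin.cases (by linarith) (fun i' => Fin.cases ?_ (fun j => ?_) i') i
  · change y 1 = y' 1
    linarith
  · exact congrFun h j.succ.succ

/-- The range of `L` is the even sublattice. [folklore] -/
theorem mem_range_diagMap_iff (x : Site (d'' + 2)) : x ∈ Set.range (diagMap d'') ↔ Even (x 0 + x 1) := by
  constructor
  · rintro ⟨y, rfl⟩
    exact ⟨y 0, by simp⟩
  · rintro ⟨a, ha⟩
    refine ⟨Fin.cons a (Fin.cons (x 1 - a) (fun j => x j.succ.succ)), ?_⟩
    funext i
    refine Fin.cases ?_ (fun i' => Fin.cases ?_ (fun j => rfl) i') i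
    · show a - (x 1 - a) = x 0
      linarith
    · change a + (x 1 - a) = x 1
      ring

variable (d'') in
/-- The **dual momentum map** `M(p) = ((p₀ − p₁)/2, (p₀ + p₁)/2, p₂, …)`, adjoint to `L`:
`M(p) · L(y) = p · y`; so `p₀` is the diagonal frequency `P = M(p)₀ + M(p)₁` and `p₁` the anti-diagonal
one `Q = M(p)₁ − M(p)₀`. [cite: AizenmanDuminilCopinAnnals2021, arXiv:1912.07973 proof of Prop. 5.4 (iii) (p. 18)] -/
def diagMomentum (p : Fin (d'' + 2) → ℝ) : Fin (d'' + 2) → ℝ :=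
  Fin.cons ((p 0 - p 1) / 2) (Fin.cons ((p 0 + p 1) / 2) (fun j => p j.succ.succ))

/-- `M(p)₀ = (p₀ − p₁)/2`. [folklore] -/
@[simp] theorem diagMomentum_zero (p : Fin (d'' + 2) → ℝ) : diagMomentum d'' p 0 = (p 0 - p 1) / 2 := rfl
/-- `M(p)₁ = (p₀ + p₁)/2`. [folklore] -/
@[simp] theorem diagMomentum_one (p : Fin (d'' + 2) → ℝ) : diagMomentum d'' p 1 = (p 0 + p 1) / 2 := rfl
/-- `M(p)_{j+2} = p_{j+2}`. [folklore] -/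
@[simp] theorem diagMomentum_succ_succ (p : Fin (d'' + 2) → ℝ) (j : Fin d'') :
    diagMomentum d'' p j.succ.succ = p j.succ.succ := rfl

/-- Sums over `Fin (d''+2)` split off the first two coordinates. [folklore] -/
theorem sum_fin_add_two {M : Type*} [AddCommMonoid M] (f : Fin (d'' + 2) → M) :
    ∑ i, f i = f 0 + f 1 + ∑ j : Fin d'', f j.succ.succ := by
  rw [Fin.sum_univ_succ, Fin.sum_univ_succ, ← add_assoc]
  rfl

/-- **Adjointness**: `M(p) · L(y) = p · y`. [folklore] -/
theorem phase_diagMomentum_diagMap (p : Fin (d'' + 2) → ℝ) (y : Site (d'' + 2)) :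
    phase (d'' + 2) (diagMomentum d'' p) (diagMap d'' y) = phase (d'' + 2) p y := by
  unfold phase
  rw [sum_fin_add_two, sum_fin_add_two]
  simp only [diagMomentum_zero, diagMomentum_one, diagMomentum_succ_succ, diagMap_zero, diagMap_one,
    diagMap_succ_succ]
  push_cast
  ring

/-- The inverse dual map: every lattice momentum `r` is `M(p)` with `p = (r₀ + r₁, r₁ − r₀, r₂, …)`. [folklore] -/
theorem diagMomentum_of (r : Fin (d'' + 2) → ℝ) :
    diagMomentum d'' (Fin.cons (r 0 + r 1) (Fin.cons (r 1 - r 0) (fun j => r j.succ.succ))) = r := by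
  funext i
  refine Fin.cases ?_ (fun i' => Fin.cases ?_ (fun j => rfl) i') i
  · show ((r 0 + r 1) - (r 1 - r 0)) / 2 = r 0
    ring
  · change ((r 0 + r 1) + (r 1 - r 0)) / 2 = r 1
    ring

/-- `‖y‖_∞ ≤ ‖L(y)‖_∞`. [folklore] -/
theorem supNorm_le_supNorm_diagMap (y : Site (d'' + 2)) : Site.supNorm y ≤ Site.supNorm (diagMap d'' y) := by
  unfold Site.supNorm
  refine Finset.sup_le fun i _ => ?_
  have h0 : (diagMap d'' y 0).natAbs ≤ Finset.univ.sup fun i => (diagMap d'' y i).natAbs :=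
    Finset.le_sup (f := fun i => (diagMap d'' y i).natAbs) (Finset.mem_univ 0)
  have h1 : (diagMap d'' y 1).natAbs ≤ Finset.univ.sup fun i => (diagMap d'' y i).natAbs :=
    Finset.le_sup (f := fun i => (diagMap d'' y i).natAbs) (Finset.mem_univ 1)
  simp only [diagMap_zero, diagMap_one] at h0 h1
  refine Fin.cases ?_ (fun i' => Fin.cases ?_ (fun j => ?_) i') i
  · -- `2|y 0| ≤ |y0 - y1| + |y0 + y1|`
    have : 2 * (y 0).natAbs ≤ (y 0 - y 1).natAbs + (y 0 + y 1).natAbs := by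
      have := Int.natAbs_add_le (y 0 - y 1) (y 0 + y 1)
      have e : y 0 - y 1 + (y 0 + y 1) = 2 * y 0 := by ring
      rw [e, Int.natAbs_mul] at this
      simpa using this
    omega
  · change (y 1).natAbs ≤ _
    have : 2 * (y 1).natAbs ≤ (y 0 + y 1).natAbs + (y 0 - y 1).natAbs := by
      have := Int.natAbs_sub_le (y 0 + y 1) (y 0 - y 1)
      have e : y 0 + y 1 - (y 0 - y 1) = 2 * y 1 := by ring
      rw [e, Int.natAbs_mul] at this
      simpa using this
    omega
  · exact Finset.le_sup (f := fun i => (diagMap d'' y i).natAbs) (Finset.mem_univ j.succ.succ)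

end DiagMap

/-! ### Part 3. The diagonal Fourier sum through representatives, and its infinite-volume limit -/

section Limit

variable {d'' : ℕ}

/-- **The projection of `L(y)` is the even site with pulled-back coordinates `ȳ`**:
`π(L(y)) = (2ȳ₀, (ȳ₁, ȳ₂, …) + ȳ₀ e_b)`. [folklore] -/
theorem rotProj_diagMap {N : ℕ} [NeZero N] (y : Site (d'' + 2)) :
    rotProj d'' N (diagMap d'' y) =
      (twoMul (Torus.proj N y 0), Fin.tail (Torus.proj N y) + layerShift (Torus.proj N y 0)) := by
  ext j
  · rw [rotProj_apply_fst, diagMap_zero, diagMap_one, twoMul, Torus.proj_apply]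
    have e1 : (y 0 - y 1 + (y 0 + y 1) : ℤ) = 2 * y 0 := by ring
    have e2 : (((2 * ((y 0 : ℤ) : ZMod N).val : ℕ)) : ZMod (2 * N)) = (((2 * (((y 0 : ℤ) : ZMod N).val : ℤ) : ℤ)) : ZMod (2 * N)) := by
      push_cast; ring
    rw [e1, e2, ZMod.intCast_eq_intCast_iff_dvd_sub, ZMod.val_intCast, Int.emod_def]
    exact ⟨-(y 0 / N), by push_cast; ring⟩
  · rw [rotProj_apply_snd]
    simp only [Pi.add_apply, Fin.tail, layerShift]
    refine Fin.cases ?_ (fun l => ?_) j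
    · simp only [Fin.succ_zero_eq_one, diagMap_one, Pi.single_eq_same, Torus.proj_apply]
      push_cast
      ring
    · simp only [diagMap_succ_succ, Pi.single_eq_of_ne (Fin.succ_ne_zero l), Torus.proj_apply, add_zero]

variable (d'') in
/-- **The real diagonal Fourier sum through representatives**:
`Σ_N(k̂) = ∑_{y ∈ C_N} ⟨σ₀σ_{π(L y)}⟩^{rot}_{N;β} cos(p_{k̂}·y)`, `p_{k̂} = 2πk̂/N` — the real part of
`D_N(k̂₀, tail k̂)` (see `re_sum_rotTwoPoint_mul_conj_eq_rotDiagSum`). [cite: AizenmanDuminilCopinAnnals2021, arXiv:1912.07973 proof of Prop. 5.4 (iii) (p. 18)] -/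
def rotDiagSum (N : ℕ) [NeZero N] (β : ℝ) (k : TorusSite (d'' + 2) N) : ℝ :=
  ∑ y ∈ centredCube (d'' + 2) N, rotTwoPoint d'' N β 0 (rotProj d'' N (diagMap d'' y)) *
    Real.cos (phase (d'' + 2) (latticeMomentum N k) y)

/-- The character of `(ℤ/Nℤ)^{d''+2}` splits off its first coordinate. [folklore] -/
theorem torusChar_eq_stdAddChar_mul_tail {N : ℕ} [NeZero N] (k u : TorusSite (d'' + 2) N) :
    torusChar k u = ZMod.stdAddChar (k 0 * u 0) * torusChar (Fin.tail k) (Fin.tail u) := by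
  unfold torusChar
  rw [Fin.prod_univ_succ]
  rfl

/-- **The diagonal Fourier transform of the rotated torus, real part, through representatives**:
`Re ∑_{m,v} ⟨σ₀σ_{(2m, v+me_b)}⟩^{rot} conj(e(k̂₀ m)χ_{tail k̂}(v)) = Σ_N(k̂)`. [folklore] -/
theorem re_sum_rotTwoPoint_mul_conj_eq_rotDiagSum {N : ℕ} [NeZero N] (β : ℝ) (k : TorusSite (d'' + 2) N) :
    (∑ m : ZMod N, ∑ v : TorusSite (d'' + 1) N,
        (rotTwoPoint d'' N β 0 (twoMul m, v + layerShift m) : ℂ) * conj (ZMod.stdAddChar (k 0 * m) * torusChar (Fin.tail k) v)).re =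
      rotDiagSum d'' N β k := by
  -- `(m, v) ↔ u = Fin.cons m v`
  have h1 : ∑ m : ZMod N, ∑ v : TorusSite (d'' + 1) N,
      (rotTwoPoint d'' N β 0 (twoMul m, v + layerShift m) : ℂ) * conj (ZMod.stdAddChar (k 0 * m) * torusChar (Fin.tail k) v) =
      ∑ u : TorusSite (d'' + 2) N, (rotTwoPoint d'' N β 0 (twoMul (u 0), Fin.tail u + layerShift (u 0)) : ℂ) * conj (torusChar k u) := by
    rw [← Fintype.sum_prod_type']
    refine (Fintype.sum_equiv (Fin.consEquiv fun _ => ZMod N) _ _ fun q => ?_)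
    have ht : Fin.tail ((Fin.consEquiv fun _ => ZMod N) q) = q.2 := by
      funext j; simp [Fin.consEquiv, Fin.tail]
    have h0 : ((Fin.consEquiv fun _ => ZMod N) q) 0 = q.1 := by simp [Fin.consEquiv]
    rw [ht, torusChar_eq_stdAddChar_mul_tail, ht, h0]
  rw [h1, Complex.re_sum, sum_torus_eq_sum_centredCube, rotDiagSum]
  refine Finset.sum_congr rfl fun y _ => ?_
  rw [Complex.re_ofReal_mul, Complex.conj_re, torusChar_re, cos_latticeMomentum_val_proj_eq, rotProj_diagMap]

variable (d'') in
/-- **The Fourier transform of the two-point function along the even sublattice**, in the diagonal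
coordinates: `T_β(p) = ∑_{y ∈ ℤ^{d''+2}} ⟨σ₀σ_{L(y)}⟩⁺_β cos(p·y)` (`= ½ Ŝ^{mod}_β(M p)`, see
`twoPointPlusFourierDiag_eq`). [cite: AizenmanDuminilCopinAnnals2021, arXiv:1912.07973 Prop. 5.4 (iii) (`Ŝ^{mod}`, p. 18)] -/
def twoPointPlusFourierDiag (β : ℝ) (p : Fin (d'' + 2) → ℝ) : ℝ :=
  ∑' y : Site (d'' + 2), twoPointPlus (d'' + 2) β (diagMap d'' y) * Real.cos (phase (d'' + 2) p y)

/-- **Pointwise convergence of the rotated-torus two-point function** in `Tendsto` form: for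
`0 ≤ β < β_c`, `⟨σ₀σ_{π(x)}⟩^{rot}_{N_j;β} → ⟨σ₀σ_x⟩⁺_β`. [cite: AizenmanDuminilCopinAnnals2021, arXiv:1912.07973 Prop. 5.2 (p. 17)] -/
theorem tendsto_rotTwoPoint_proj {β : ℝ} (hβ : 0 ≤ β) (hβc : β < criticalBeta (d'' + 2))
    {Nseq : ℕ → ℕ} [∀ j, NeZero (Nseq j)] (hN : Tendsto Nseq atTop atTop) (x : Site (d'' + 2)) :
    Tendsto (fun j => rotTwoPoint d'' (Nseq j) β 0 (rotProj d'' (Nseq j) x)) atTop (𝓝 (twoPointPlus (d'' + 2) β x)) := by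
  rcases eq_or_ne x 0 with rfl | hx
  · have : ∀ j, rotTwoPoint d'' (Nseq j) β 0 (rotProj d'' (Nseq j) 0) = 1 := fun j => by
      rw [map_zero]; simp [rotTwoPoint]
    simp only [this, twoPointPlus_zero]
    exact tendsto_const_nhds
  · have hm : spontaneousMagnetization (d'' + 2) β = 0 := spontaneousMagnetization_eq_zero_of_lt_criticalBeta_holds hβ hβc
    rw [Metric.tendsto_atTop]
    intro ε hε
    obtain ⟨N₀, hN₀⟩ := abs_rotTwoPoint_sub_plusCorr_le (d'' := d'') hβ (x := 0) (y := x) hx.symm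
      (freeCorr_eq_plusCorr_of_spontaneousMagnetization_eq_zero hβ hm _) (half_pos hε)
    obtain ⟨j₀, hj₀⟩ := eventually_atTop.1 (hN.eventually (eventually_ge_atTop N₀))
    refine ⟨j₀, fun j hj => ?_⟩
    have key := hN₀ (Nseq j) (hj₀ j hj)
    rw [map_zero] at key
    rw [Real.dist_eq, twoPointPlus_eq_plusCorr_pair β hx]
    exact key.trans_lt (half_lt_self hε)

/-- **The diagonal Fourier modes of the rotated torus converge to `T_β`** (the analogue of ADC
Prop. 5.2, third item, for the rotated periodic boxes: "for `β < β_c(ρ)` the change does not affect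
the two-point function's infinite volume limit"): for `0 ≤ β < β_c(d''+2)`, along any rotated tori
`N_j → ∞` and lattice momenta `2πk̂_j/N_j → p`, `Σ_{N_j}(k̂_j) → T_β(p)`. Dominated convergence over
`ℤ^{d''+2}`: pointwise convergence (`RotatedTorus`, Griffiths sandwich) and the uniform decay on the
diagonal representative domain (`exists_uniform_decay_rotTwoPoint_diag`). [cite: AizenmanDuminilCopinAnnals2021, arXiv:1912.07973 Prop. 5.2 and proof of Prop. 5.4 (iii) (p. 17–18)] -/
theorem tendsto_rotDiagSum {β : ℝ} (hβ : 0 ≤ β) (hβc : β < criticalBeta (d'' + 2))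
    {Nseq : ℕ → ℕ} [∀ j, NeZero (Nseq j)] (hN : Tendsto Nseq atTop atTop)
    (k : ∀ j : ℕ, TorusSite (d'' + 2) (Nseq j)) {p : Fin (d'' + 2) → ℝ}
    (hk : ∀ i, Tendsto (fun j => latticeMomentum (Nseq j) (k j) i) atTop (𝓝 (p i))) :
    Tendsto (fun j => rotDiagSum d'' (Nseq j) β (k j)) atTop (𝓝 (twoPointPlusFourierDiag d'' β p)) := by
  classical
  obtain ⟨R, θ, hR1, hθ0, hθ1, hdecay⟩ := exists_uniform_decay_rotTwoPoint_diag (d'' := d'') hβ hβc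
  set θ' : ℝ := max θ (1 / 2) with hθ'
  have hθ'pos : 0 < θ' := lt_max_of_lt_right one_half_pos
  have hθ'1 : θ' < 1 := max_lt hθ1 one_half_lt_one
  have hθθ' : θ ≤ θ' := le_max_left _ _
  set c : ℝ := -Real.log θ' / (4 * (R + 1)) with hc
  have hcpos : 0 < c := div_pos (neg_pos.2 (Real.log_neg hθ'pos hθ'1)) (by positivity)
  set bound : Site (d'' + 2) → ℝ := fun x => θ'⁻¹ * Real.exp (-c * ‖x‖) with hbound
  have hbound_summ : Summable bound := by
    obtain ⟨B, hB⟩ := sum_box_exp_neg_mul_norm_le (d := d'' + 2) hcpos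
    have hs : Summable fun x : Site (d'' + 2) => Real.exp (-c * ‖x‖) := by
      refine summable_of_sum_le (c := B) (fun x => (Real.exp_pos _).le) fun s => ?_
      obtain ⟨N, hN⟩ := exists_forall_subset_box (d'' + 2) s
      exact (Finset.sum_le_sum_of_subset_of_nonneg (hN N le_rfl) fun x _ _ => (Real.exp_pos _).le).trans (hB N)
    exact hs.mul_left θ'⁻¹
  have hpow_le : ∀ y : Site (d'' + 2), θ ^ (Site.supNorm (diagMap d'' y) / (4 * (R + 1))) ≤ bound y := by
    intro y
    refine (pow_le_pow_left₀ hθ0 hθθ' _).trans ?_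
    refine (pow_le_pow_of_le_one hθ'pos.le hθ'1.le
      (Nat.div_le_div_right (supNorm_le_supNorm_diagMap y))).trans ?_
    have := pow_div_le_inv_mul_exp hθ'pos hθ'1.le (L := 4 * (R + 1)) (by omega) (Site.supNorm y)
    show θ' ^ (Site.supNorm y / (4 * (R + 1))) ≤ θ'⁻¹ * Real.exp (-c * ‖y‖)
    rw [Site.norm_eq_supNorm]
    push_cast at this ⊢
    exact this
  set f : ℕ → Site (d'' + 2) → ℝ := fun j y => if y ∈ centredCube (d'' + 2) (Nseq j) then
    rotTwoPoint d'' (Nseq j) β 0 (rotProj d'' (Nseq j) (diagMap d'' y)) *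
      Real.cos (phase (d'' + 2) (latticeMomentum (Nseq j) (k j)) y) else 0 with hf
  have hsum : ∀ j, rotDiagSum d'' (Nseq j) β (k j) = ∑' y, f j y := by
    intro j
    rw [rotDiagSum, tsum_eq_sum (s := centredCube (d'' + 2) (Nseq j))]
    · exact Finset.sum_congr rfl fun y hy => by rw [hf]; simp only [if_pos hy]
    · intro y hy; rw [hf]; simp only [if_neg hy]
  simp only [hsum]
  unfold twoPointPlusFourierDiag
  refine tendsto_tsum_of_dominated_convergence hbound_summ (fun y => ?_) ?_
  · have hmem : ∀ᶠ j in atTop, y ∈ centredCube (d'' + 2) (Nseq j) := by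
      filter_upwards [hN.eventually (eventually_gt_atTop (2 * Site.supNorm y))] with j hj
      rw [mem_centredCube]
      intro i
      have := Site.natAbs_le_supNorm y i
      constructor <;> omega
    have hG := tendsto_rotTwoPoint_proj hβ hβc hN (diagMap d'' y)
    have hcos : Tendsto (fun j => Real.cos (phase (d'' + 2) (latticeMomentum (Nseq j) (k j)) y)) atTop
        (𝓝 (Real.cos (phase (d'' + 2) p y))) := by
      refine (Real.continuous_cos.tendsto _).comp ?_
      unfold phase
      exact tendsto_finsetSum _ fun i _ => (hk i).mul_const _
    refine (hG.mul hcos).congr' ?_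
    filter_upwards [hmem] with j hj
    rw [hf]; simp only [if_pos hj]
  · filter_upwards [hN.eventually (eventually_ge_atTop (2 * R + 4))] with j hj y
    rw [hf]
    simp only
    split_ifs with hy
    · rw [mem_centredCube] at hy
      have hs : |diagMap d'' y 0 + diagMap d'' y 1| ≤ (Nseq j : ℤ) := by
        rw [diagMap_zero, diagMap_one, show y 0 - y 1 + (y 0 + y 1) = 2 * y 0 by ring, abs_le]
        have := hy 0; constructor <;> linarith
      have hd : |diagMap d'' y 1 - diagMap d'' y 0| ≤ (Nseq j : ℤ) := by
        rw [diagMap_zero, diagMap_one, show y 0 + y 1 - (y 0 - y 1) = 2 * y 1 by ring, abs_le]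
        have := hy 1; constructor <;> linarith
      have hz : ∀ l : Fin d'', 2 * |diagMap d'' y l.succ.succ| ≤ (Nseq j : ℤ) := by
        intro l
        rw [diagMap_succ_succ, ← abs_two, ← abs_mul, abs_le]
        have := hy l.succ.succ; constructor <;> linarith
      obtain ⟨hG0, hGle⟩ := hdecay (Nseq j) hj (diagMap d'' y) hs hd hz
      rw [Real.norm_eq_abs, abs_mul, abs_of_nonneg hG0]
      calc _ ≤ rotTwoPoint d'' (Nseq j) β 0 (rotProj d'' (Nseq j) (diagMap d'' y)) * 1 :=
            mul_le_mul_of_nonneg_left (Real.abs_cos_le_one _) hG0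
        _ ≤ θ ^ (Site.supNorm (diagMap d'' y) / (4 * (R + 1))) := by rw [mul_one]; exact hGle
        _ ≤ bound y := hpow_le y
    · rw [norm_zero]
      exact mul_nonneg (inv_nonneg.2 hθ'pos.le) (Real.exp_pos _).le

end Limit

/-! ### Part 4. `T_β`: summability, continuity, periodicity, and `2T_β(p) = Ŝ^{mod}_β(M p)` -/

section TProps

variable {d'' : ℕ}

/-- Summability of `y ↦ ⟨σ₀σ_{L y}⟩⁺ cos(p·y)` below `β_c`. [folklore] -/
theorem summable_twoPointPlus_diagMap_mul_cos {β : ℝ} (hβ : 0 ≤ β) (hβc : β < criticalBeta (d'' + 2)) (p : Fin (d'' + 2) → ℝ) :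
    Summable fun y : Site (d'' + 2) => twoPointPlus (d'' + 2) β (diagMap d'' y) * Real.cos (phase (d'' + 2) p y) := by
  have hS := (summable_twoPointPlus_of_lt_criticalBeta (d := d'' + 2) (by omega) hβ hβc).comp_injective diagMap_injective
  refine Summable.of_norm_bounded hS fun y => ?_
  rw [Real.norm_eq_abs, abs_mul, Function.comp_apply, abs_of_nonneg (twoPointPlus_nonneg_of_gks hβ _)]
  exact mul_le_of_le_one_right (twoPointPlus_nonneg_of_gks hβ _) (Real.abs_cos_le_one _)

/-- **`T_β` is continuous** (uniformly convergent Fourier series). [folklore] -/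
theorem continuous_twoPointPlusFourierDiag {β : ℝ} (hβ : 0 ≤ β) (hβc : β < criticalBeta (d'' + 2)) :
    Continuous (twoPointPlusFourierDiag d'' β) := by
  have hS := (summable_twoPointPlus_of_lt_criticalBeta (d := d'' + 2) (by omega) hβ hβc).comp_injective diagMap_injective
  refine continuous_tsum (fun y => continuous_const.mul ((Real.continuous_cos).comp ?_)) hS fun p y => ?_
  · unfold phase
    exact continuous_finsetSum _ fun i _ => (continuous_apply i).mul continuous_const
  · rw [Real.norm_eq_abs, abs_mul, Function.comp_apply, abs_of_nonneg (twoPointPlus_nonneg_of_gks hβ _)]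
    exact mul_le_of_le_one_right (twoPointPlus_nonneg_of_gks hβ _) (Real.abs_cos_le_one _)

/-- **Periodicity**: `T(p') = T(p)` if `p' − p ∈ 2πℤ^{d''+2}`. [folklore] -/
theorem twoPointPlusFourierDiag_eq_of_sub_mem (β : ℝ) {p p' : Fin (d'' + 2) → ℝ}
    (h : ∀ i, ∃ m : ℤ, p' i = p i + m * (2 * Real.pi)) :
    twoPointPlusFourierDiag d'' β p' = twoPointPlusFourierDiag d'' β p := by
  choose m hm using h
  unfold twoPointPlusFourierDiag
  refine tsum_congr fun y => ?_
  congr 1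
  have : phase (d'' + 2) p' y = phase (d'' + 2) p y + ((∑ i, m i * y i : ℤ) : ℝ) * (2 * Real.pi) := by
    unfold phase
    push_cast
    simp only [hm, Finset.sum_mul, ← Finset.sum_add_distrib]
    exact Finset.sum_congr rfl fun i _ => by ring
  rw [this, Real.cos_add_int_mul_two_pi]

/-- `T` is unchanged by the reduction of momenta mod `2π`. [folklore] -/
theorem twoPointPlusFourierDiag_reduceMomentum (β : ℝ) (p : Fin (d'' + 2) → ℝ) :
    twoPointPlusFourierDiag d'' β (reduceMomentum p) = twoPointPlusFourierDiag d'' β p :=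
  twoPointPlusFourierDiag_eq_of_sub_mem β fun i => ⟨-⌊p i / (2 * Real.pi)⌋, by unfold reduceMomentum; push_cast; ring⟩

variable (d'') in
/-- The diagonal shift `π(e₀ + e₁)` in momentum space. [folklore] -/
def piDiag : Fin (d'' + 2) → ℝ := Fin.cons Real.pi (Fin.cons Real.pi (fun _ => 0))

/-- First coordinate `π`. [folklore] -/
@[simp] theorem piDiag_zero : piDiag d'' 0 = Real.pi := rfl
/-- Second coordinate `π`. [folklore] -/
@[simp] theorem piDiag_one : piDiag d'' 1 = Real.pi := rfl
/-- Other coordinates `0`. [folklore] -/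
@[simp] theorem piDiag_succ_succ (j : Fin d'') : piDiag d'' j.succ.succ = 0 := rfl

/-- `(r + π(1,1,0,…))·x = r·x + (x₀ + x₁)π`. [folklore] -/
theorem phase_add_piDiag (r : Fin (d'' + 2) → ℝ) (x : Site (d'' + 2)) :
    phase (d'' + 2) (r + piDiag d'') x = phase (d'' + 2) r x + ((x 0 + x 1 : ℤ) : ℝ) * Real.pi := by
  unfold phase
  rw [sum_fin_add_two, sum_fin_add_two]
  simp only [Pi.add_apply, piDiag_zero, piDiag_one, piDiag_succ_succ, add_zero]
  push_cast
  ring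

/-- **`2 T_β(p) = Ŝ_β(M p) + Ŝ_β(M p + π(1,1,0,…)) = Ŝ^{mod}_β(M p)`**: the sum over the even
sublattice is half the modified Fourier transform (for `0 ≤ β < β_c`, where all series converge
absolutely). [cite: AizenmanDuminilCopinAnnals2021, arXiv:1912.07973 Prop. 5.4 (iii) (`Ŝ^{mod}`, p. 18)] -/
theorem two_mul_twoPointPlusFourierDiag_eq {β : ℝ} (hβ : 0 ≤ β) (hβc : β < criticalBeta (d'' + 2)) (p : Fin (d'' + 2) → ℝ) :
    2 * twoPointPlusFourierDiag d'' β p =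
      twoPointPlusFourier (d'' + 2) β (diagMomentum d'' p) + twoPointPlusFourier (d'' + 2) β (diagMomentum d'' p + piDiag d'') := by
  set r := diagMomentum d'' p with hr
  have hs1 := summable_twoPointPlus_mul_cos (d := d'' + 2) (by omega) hβ hβc r
  have hs2 := summable_twoPointPlus_mul_cos (d := d'' + 2) (by omega) hβ hβc (r + piDiag d'')
  unfold twoPointPlusFourier
  rw [← hs1.tsum_add hs2]
  -- pointwise: `S(x)[cos(r·x) + cos(r·x + (x₀+x₁)π)] = 2 S(x) cos(r·x) 𝟙{x₀+x₁ even}`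
  have hpt : ∀ x : Site (d'' + 2), twoPointPlus (d'' + 2) β x * Real.cos (phase (d'' + 2) r x) +
      twoPointPlus (d'' + 2) β x * Real.cos (phase (d'' + 2) (r + piDiag d'') x) =
      if Even (x 0 + x 1) then 2 * (twoPointPlus (d'' + 2) β x * Real.cos (phase (d'' + 2) r x)) else 0 := by
    intro x
    rw [phase_add_piDiag, Real.cos_add_int_mul_pi]
    split_ifs with he
    · rw [he.neg_one_zpow]; ring
    · rw [(Int.not_even_iff_odd.1 he).neg_one_zpow]; ring
  simp only [hpt]
  -- the indicator sum is the sum over the range of `L`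
  have key : ∑' x : Site (d'' + 2), (if Even (x 0 + x 1) then 2 * (twoPointPlus (d'' + 2) β x * Real.cos (phase (d'' + 2) r x)) else 0) =
      ∑' y : Site (d'' + 2), 2 * (twoPointPlus (d'' + 2) β (diagMap d'' y) * Real.cos (phase (d'' + 2) r (diagMap d'' y))) := by
    rw [← diagMap_injective.tsum_eq]
    · refine tsum_congr fun y => ?_
      rw [if_pos ((mem_range_diagMap_iff _).1 ⟨y, rfl⟩)]
    · intro x hx
      rw [Function.mem_support] at hx
      rw [mem_range_diagMap_iff]
      by_contra he
      exact hx (if_neg he)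
  rw [key, tsum_mul_left]
  unfold twoPointPlusFourierDiag
  congr 1
  refine tsum_congr fun y => ?_
  rw [hr, phase_diagMomentum_diagMap]

/-- **`Ŝ_β` is invariant under coordinate permutations** (`⟨σ₀σ_x⟩⁺` is, `twoPointPlus_signedPerm`).
[cite: FriedliVelenik2017, Exercise 3.14] -/
theorem twoPointPlusFourier_comp_perm {d : ℕ} (β : ℝ) (π : Equiv.Perm (Fin d)) (p : Fin d → ℝ) :
    twoPointPlusFourier d β (p ∘ π) = twoPointPlusFourier d β p := by
  unfold twoPointPlusFourier
  -- reindex `x ↦ x ∘ π` (the signed permutation with trivial signs and permutation `π⁻¹`)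
  rw [← Equiv.tsum_eq (Site.signedPerm π.symm (fun _ => 1))]
  refine tsum_congr fun x => ?_
  rw [twoPointPlus_signedPerm]
  congr 1
  unfold phase
  have : (fun i => (p ∘ π) i * ((Site.signedPerm π.symm (fun _ => 1) x i : ℤ) : ℝ)) =
      fun i => (fun j => p j * (x j : ℝ)) (π i) := by
    funext i; simp [Site.signedPerm_apply]
  rw [this, Equiv.sum_comp π (fun j => p j * (x j : ℝ))]

/-- **The anti-diagonal symmetry of `T`**: `T(P, Q, p') = T(−Q, −P, p')` (from the evenness of `Ŝ`
in the second lattice coordinate, through `2T = Ŝ^{mod} ∘ M`). [folklore] -/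
theorem twoPointPlusFourierDiag_swap_neg {β : ℝ} (hβ : 0 ≤ β) (hβc : β < criticalBeta (d'' + 2)) (p : Fin (d'' + 2) → ℝ) :
    twoPointPlusFourierDiag d'' β p =
      twoPointPlusFourierDiag d'' β (Fin.cons (-p 1) (Fin.cons (-p 0) (fun j => p j.succ.succ))) := by
  set p' : Fin (d'' + 2) → ℝ := Fin.cons (-p 1) (Fin.cons (-p 0) (fun j => p j.succ.succ)) with hp'
  have h2 : (2 : ℝ) ≠ 0 := two_ne_zero
  apply mul_left_cancel₀ h2
  rw [two_mul_twoPointPlusFourierDiag_eq hβ hβc, two_mul_twoPointPlusFourierDiag_eq hβ hβc]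
  -- `M p' = (M p) with the second coordinate negated`
  have hM : diagMomentum d'' p' = Function.update (diagMomentum d'' p) 1 (-(diagMomentum d'' p 1)) := by
    funext i
    refine Fin.cases ?_ (fun i' => Fin.cases ?_ (fun j => ?_) i') i
    · rw [Function.update_of_ne (show (0 : Fin (d'' + 2)) ≠ 1 by simp)]
      simp only [diagMomentum_zero, hp', Fin.cons_zero]
      change ((-p 1) - (-p 0)) / 2 = (p 0 - p 1) / 2
      ring
    · change diagMomentum d'' p' 1 = Function.update (diagMomentum d'' p) 1 (-(diagMomentum d'' p 1)) 1
      rw [Function.update_self, diagMomentum_one, diagMomentum_one]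
      change ((-p 1) + (-p 0)) / 2 = -((p 0 + p 1) / 2)
      ring
    · have hne : (j.succ.succ : Fin (d'' + 2)) ≠ 1 := fun h => Fin.succ_ne_zero j (Fin.succ_injective _ (h.trans rfl))
      rw [Function.update_of_ne hne, diagMomentum_succ_succ, diagMomentum_succ_succ]
      rfl
  have hM2 : diagMomentum d'' p' + piDiag d'' =
      Function.update (Function.update (diagMomentum d'' p + piDiag d'') 1 (-((diagMomentum d'' p + piDiag d'') 1))) 1
        (-((diagMomentum d'' p + piDiag d'') 1) + (1 : ℤ) * (2 * Real.pi)) := by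
    rw [Function.update_idem, hM]
    funext i
    by_cases hi : i = 1
    · subst hi
      simp only [Pi.add_apply, Function.update_self, piDiag_one]
      push_cast
      ring
    · simp only [Pi.add_apply, Function.update_of_ne hi]
  rw [hM2, hM, twoPointPlusFourier_update_neg]
  congr 1
  set Y := diagMomentum d'' p + piDiag d'' with hY
  have e1 : twoPointPlusFourier (d'' + 2) β (Function.update (Function.update Y 1 (-Y 1)) 1 (-Y 1 + (1 : ℤ) * (2 * Real.pi))) =
      twoPointPlusFourier (d'' + 2) β (Function.update Y 1 (-Y 1)) := by
    refine twoPointPlusFourier_eq_of_sub_mem β fun i => ?_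
    by_cases hi : i = 1
    · subst hi; exact ⟨1, by simp⟩
    · exact ⟨0, by simp [Function.update_of_ne hi]⟩
  rw [e1, twoPointPlusFourier_update_neg]

end TProps

/-! ### Part 5. ADC Prop. 5.4 (iii) in infinite volume, and the diagonal merging bound -/

section Monotone

variable {d'' : ℕ}

/-- **ADC Prop. 5.4 (iii) in infinite volume, strict form**: for `0 ≤ β < β_c(d''+2)`, every `p` and
`P'` with `cos P' < cos p₀`, `T_β(P', p₁, …) ≤ T_β(p)` — i.e. `Ŝ^{mod}_β` (`= 2T_β ∘ M⁻¹`) decreases as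
the diagonal frequency `p₀ = r₀ + r₁` moves away from `0` at fixed anti-diagonal frequency
`p₁ = r₁ − r₀` and fixed `r₂, …`. Limit of the exact finite-volume statement on the rotated tori
(`rotDiagFourier_zero_re_le_of_cos_le`) along `Σ_{N_j}(k̂_j) → T_β` (`tendsto_rotDiagSum`).
[cite: AizenmanDuminilCopinAnnals2021, arXiv:1912.07973 Prop. 5.4 (iii) (p. 18)] [cite: Panis2023Triviality, Prop. 3.16] -/
theorem twoPointPlusFourierDiag_update_le_of_cos_lt {β : ℝ} (hβ : 0 ≤ β) (hβc : β < criticalBeta (d'' + 2))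
    (p : Fin (d'' + 2) → ℝ) {P' : ℝ} (hcos : Real.cos P' < Real.cos (p 0)) :
    twoPointPlusFourierDiag d'' β (Function.update p 0 P') ≤ twoPointPlusFourierDiag d'' β p := by
  rw [← twoPointPlusFourierDiag_reduceMomentum β p, ← twoPointPlusFourierDiag_reduceMomentum β (Function.update p 0 P'),
    reduceMomentum_update]
  set pr := reduceMomentum p with hpr
  set qr := P' - ⌊P' / (2 * Real.pi)⌋ * (2 * Real.pi) with hqr
  have hprmem := reduceMomentum_mem p
  have hqrmem : 0 ≤ qr ∧ qr < 2 * Real.pi :=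
    ⟨Int.sub_floor_div_mul_nonneg P' (by positivity), Int.sub_floor_div_mul_lt P' (by positivity)⟩
  have hpr'mem : ∀ l, 0 ≤ Function.update pr 0 qr l ∧ Function.update pr 0 qr l < 2 * Real.pi := by
    intro l
    by_cases hl : l = 0
    · subst hl; simpa using hqrmem
    · rw [Function.update_of_ne hl]; exact hprmem l
  have hk := tendsto_latticeMomentum_approxMomentum hprmem
  have hk' := tendsto_latticeMomentum_approxMomentum hpr'mem
  have hlim := tendsto_rotDiagSum (d'' := d'') hβ hβc tendsto_two_mul_add_four (approxMomentum pr) hk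
  have hlim' := tendsto_rotDiagSum (d'' := d'') hβ hβc tendsto_two_mul_add_four (approxMomentum (Function.update pr 0 qr)) hk'
  refine le_of_tendsto_of_tendsto hlim' hlim ?_
  have hc' : Tendsto (fun j => Real.cos (latticeMomentum (2 * j + 4) (approxMomentum (Function.update pr 0 qr) j) 0))
      atTop (𝓝 (Real.cos P')) := by
    have := (Real.continuous_cos.tendsto _).comp (hk' 0)
    rw [Function.update_self] at this
    have hqq : Real.cos qr = Real.cos P' := by
      rw [hqr, sub_eq_add_neg, ← neg_mul, show -(⌊P' / (2 * Real.pi)⌋ : ℝ) * (2 * Real.pi) =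
        ((-⌊P' / (2 * Real.pi)⌋ : ℤ) : ℝ) * (2 * Real.pi) by push_cast; ring, Real.cos_add_int_mul_two_pi]
    rwa [hqq] at this
  have hc : Tendsto (fun j => Real.cos (latticeMomentum (2 * j + 4) (approxMomentum pr j) 0)) atTop (𝓝 (Real.cos (p 0))) := by
    have := (Real.continuous_cos.tendsto _).comp (hk 0)
    rw [cos_reduceMomentum] at this
    exact this
  filter_upwards [hc'.eventually_lt hc hcos] with j hj
  rw [← re_sum_rotTwoPoint_mul_conj_eq_rotDiagSum, ← re_sum_rotTwoPoint_mul_conj_eq_rotDiagSum]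
  have htail : Fin.tail (approxMomentum (Function.update pr 0 qr) j) = Fin.tail (approxMomentum pr j) := by
    rw [approxMomentum_update]
    exact Fin.tail_update_zero _ _
  rw [htail]
  refine rotDiagFourier_zero_re_le_of_cos_le (by omega) β _ ?_
  unfold latticeMomentum at hj
  exact hj.le

/-- **ADC Prop. 5.4 (iii), anti-diagonal form (strict)**: for `0 ≤ β < β_c`, `T_β(p₀, Q', p₂, …) ≤
T_β(p)` whenever `cos Q' < cos p₁` — `Ŝ^{mod}_β` decreases in the anti-diagonal frequency
`|r₁ − r₀|` at fixed `r₀ + r₁` (the printed form: "decreasing function of `|p₁ − p₂|` restricted to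
`p₁ + p₂ =` constant"), by the symmetry `T(P, Q, ·) = T(−Q, −P, ·)`. [cite: AizenmanDuminilCopinAnnals2021, arXiv:1912.07973 Prop. 5.4 (iii) (p. 18)] [cite: Panis2023Triviality, Prop. 3.16] -/
theorem twoPointPlusFourierDiag_update_one_le_of_cos_lt {β : ℝ} (hβ : 0 ≤ β) (hβc : β < criticalBeta (d'' + 2))
    (p : Fin (d'' + 2) → ℝ) {Q' : ℝ} (hcos : Real.cos Q' < Real.cos (p 1)) :
    twoPointPlusFourierDiag d'' β (Function.update p 1 Q') ≤ twoPointPlusFourierDiag d'' β p := by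
  rw [twoPointPlusFourierDiag_swap_neg hβ hβc p, twoPointPlusFourierDiag_swap_neg hβ hβc (Function.update p 1 Q')]
  have h10 : (1 : Fin (d'' + 2)) ≠ 0 := by simp
  have hupd : (Fin.cons (-(Function.update p 1 Q') 1) (Fin.cons (-(Function.update p 1 Q') 0)
      fun j => (Function.update p 1 Q') j.succ.succ) : Fin (d'' + 2) → ℝ) =
      Function.update (Fin.cons (-p 1) (Fin.cons (-p 0) fun j => p j.succ.succ)) 0 (-Q') := by
    set base : Fin (d'' + 2) → ℝ := Fin.cons (-p 1) (Fin.cons (-p 0) fun j => p j.succ.succ) with hbase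
    funext i
    refine Fin.cases ?_ (fun i' => Fin.cases ?_ (fun j => ?_) i') i
    · simp
    · change -(Function.update p 1 Q') 0 = Function.update base 0 (-Q') 1
      rw [Function.update_of_ne h10.symm, Function.update_of_ne h10]
      rfl
    · have hne1 : (j.succ.succ : Fin (d'' + 2)) ≠ 1 := fun h => Fin.succ_ne_zero j (Fin.succ_injective _ h)
      have hne0 : (j.succ.succ : Fin (d'' + 2)) ≠ 0 := Fin.succ_ne_zero _
      change (Function.update p 1 Q') j.succ.succ = Function.update base 0 (-Q') j.succ.succ
      rw [Function.update_of_ne hne1, Function.update_of_ne hne0]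
      rfl
  rw [hupd]
  refine twoPointPlusFourierDiag_update_le_of_cos_lt hβ hβc _ ?_
  simp only [Fin.cons_zero, Real.cos_neg]
  exact hcos

/-- **The diagonal merging bound** (the use of Prop. 5.4 (iii) in the proof of ADC Thm 5.6, via
Cor. 5.5: moving the anti-diagonal frequency from `r₁ − r₀` to `−(r₀ + r₁)` at fixed `r₀ + r₁`):
for `0 ≤ β < β_c(d''+2)` and a lattice momentum `r` with `0 < r₀`, `0 < r₁`, `r₀ + r₁ ≤ π`,
`Ŝ^{mod}_β(r₀ + r₁, 0, r₂, …) ≤ Ŝ^{mod}_β(r)`, where `Ŝ^{mod}(r) = Ŝ(r) + Ŝ(r + π(1,1,0,…))`.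
[cite: AizenmanDuminilCopinAnnals2021, arXiv:1912.07973 Prop. 5.4 (iii) and Cor. 5.5 (p. 18–19)] -/
theorem twoPointPlusFourier_mod_merge_le {β : ℝ} (hβ : 0 ≤ β) (hβc : β < criticalBeta (d'' + 2))
    (r : Fin (d'' + 2) → ℝ) (h0 : 0 < r 0) (h1 : 0 < r 1) (hπ : r 0 + r 1 ≤ Real.pi) :
    twoPointPlusFourier (d'' + 2) β (Function.update (Function.update r 0 (r 0 + r 1)) 1 0) +
        twoPointPlusFourier (d'' + 2) β (Function.update (Function.update r 0 (r 0 + r 1)) 1 0 + piDiag d'') ≤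
      twoPointPlusFourier (d'' + 2) β r + twoPointPlusFourier (d'' + 2) β (r + piDiag d'') := by
  -- `r = M(P, Q, r')`, `r* = M(P, -P, r')` with `P = r₀ + r₁`, `Q = r₁ - r₀`
  set p : Fin (d'' + 2) → ℝ := Fin.cons (r 0 + r 1) (Fin.cons (r 1 - r 0) (fun j => r j.succ.succ)) with hp
  have hr : diagMomentum d'' p = r := diagMomentum_of r
  have hr' : diagMomentum d'' (Function.update p 1 (-(r 0 + r 1))) = Function.update (Function.update r 0 (r 0 + r 1)) 1 0 := by
    funext i
    refine Fin.cases ?_ (fun i' => Fin.cases ?_ (fun j => ?_) i') i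
    · rw [diagMomentum_zero, Function.update_of_ne (show (0 : Fin (d'' + 2)) ≠ 1 by simp), Function.update_self,
        Function.update_of_ne (show (0 : Fin (d'' + 2)) ≠ 1 by simp), Function.update_self]
      simp only [hp, Fin.cons_zero]
      ring
    · change diagMomentum d'' (Function.update p 1 (-(r 0 + r 1))) 1 = Function.update (Function.update r 0 (r 0 + r 1)) 1 0 1
      rw [diagMomentum_one, Function.update_of_ne (show (0 : Fin (d'' + 2)) ≠ 1 by simp), Function.update_self,
        Function.update_self]
      simp only [hp, Fin.cons_zero]
      ring
    · have hne1 : (j.succ.succ : Fin (d'' + 2)) ≠ 1 := fun h => Fin.succ_ne_zero j (Fin.succ_injective _ h)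
      have hne0 : (j.succ.succ : Fin (d'' + 2)) ≠ 0 := Fin.succ_ne_zero _
      rw [diagMomentum_succ_succ, Function.update_of_ne hne1, Function.update_of_ne hne1, Function.update_of_ne hne0]
      rfl
  have key := twoPointPlusFourierDiag_update_one_le_of_cos_lt hβ hβc p (Q' := -(r 0 + r 1)) ?_
  · have e1 := two_mul_twoPointPlusFourierDiag_eq hβ hβc p
    have e2 := two_mul_twoPointPlusFourierDiag_eq hβ hβc (Function.update p 1 (-(r 0 + r 1)))
    rw [hr] at e1
    rw [hr'] at e2
    linarith
  · -- `cos(r₀ + r₁) < cos(r₁ - r₀)` for `0 < r₀, r₁`, `r₀ + r₁ ≤ π`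
    have hp1 : p 1 = r 1 - r 0 := rfl
    rw [hp1, Real.cos_neg, ← Real.cos_abs (r 1 - r 0)]
    refine Real.cos_lt_cos_of_nonneg_of_le_pi (abs_nonneg _) hπ ?_
    rcases le_or_gt (r 0) (r 1) with h | h
    · rw [abs_of_nonneg (by linarith)]; linarith
    · rw [abs_of_neg (by linarith)]; linarith

/-- **The diagonal merging bound for `Ŝ_β`** (ADC Cor. 5.5-type lower bound, one merging step): for
`0 < β < β_c(d''+2)` and `r` with `0 ≤ r₀, r₁ ≤ π/2`,
`Ŝ_β(r₀ + r₁, 0, r₂, …) ≤ Ŝ_β(r) + 1/(4β)` — from `Ŝ^{mod}(r*) ≤ Ŝ^{mod}(r)`, `Ŝ ≥ 0` and the infrared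
bound `Ŝ(r + π(1,1,0,…)) ≤ 1/(2β ℰ(r + π(1,1,0,…))) ≤ 1/(4β)` (`ℰ ≥ 2 + cos r₀ + cos r₁ ≥ 2`); the
degenerate cases `r₀ = 0` / `r₁ = 0` by the permutation symmetry of `Ŝ`.
[cite: AizenmanDuminilCopinAnnals2021, arXiv:1912.07973 Cor. 5.5 and proof of Thm 5.6 (p. 18–20)] -/
theorem twoPointPlusFourier_merge_le {β : ℝ} (hβ : 0 < β) (hβc : β < criticalBeta (d'' + 2))
    (r : Fin (d'' + 2) → ℝ) (h0 : 0 ≤ r 0) (h1 : 0 ≤ r 1) (h0' : r 0 ≤ Real.pi / 2) (h1' : r 1 ≤ Real.pi / 2) :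
    twoPointPlusFourier (d'' + 2) β (Function.update (Function.update r 0 (r 0 + r 1)) 1 0) ≤
      twoPointPlusFourier (d'' + 2) β r + 1 / (4 * β) := by
  have hd : (1 : ℕ) ≤ d'' + 1 := by omega
  -- the infrared term
  have hE : 2 ≤ dispersion (r + piDiag d'') := by
    unfold dispersion
    rw [sum_fin_add_two]
    simp only [Pi.add_apply, piDiag_zero, piDiag_one, piDiag_succ_succ, add_zero, Real.cos_add_pi]
    have hc0 : 0 ≤ Real.cos (r 0) := Real.cos_nonneg_of_neg_pi_div_two_le_of_le (by linarith [Real.pi_pos]) h0'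
    have hc1 : 0 ≤ Real.cos (r 1) := Real.cos_nonneg_of_neg_pi_div_two_le_of_le (by linarith [Real.pi_pos]) h1'
    have hrest : 0 ≤ ∑ j : Fin d'', (1 - Real.cos (r j.succ.succ)) :=
      Finset.sum_nonneg fun j _ => by linarith [Real.cos_le_one (r j.succ.succ)]
    linarith
  have hIR : twoPointPlusFourier (d'' + 2) β (r + piDiag d'') ≤ 1 / (4 * β) := by
    have := twoPointPlusFourier_le_infrared (d' := d'' + 1) hd hβ hβc (p := r + piDiag d'') (by linarith)
    refine this.trans ?_
    rw [div_le_div_iff₀ (by positivity) (by positivity)]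
    nlinarith
  have hnonneg := twoPointPlusFourier_nonneg (d' := d'' + 1) hd hβ.le hβc
    (Function.update (Function.update r 0 (r 0 + r 1)) 1 0 + piDiag d'')
  rcases h0.lt_or_eq with h0p | h00
  · rcases h1.lt_or_eq with h1p | h10
    · have := twoPointPlusFourier_mod_merge_le hβ.le hβc r h0p h1p (by linarith)
      linarith
    · -- `r₁ = 0`: `r* = r`
      have : Function.update (Function.update r 0 (r 0 + r 1)) 1 0 = r := by
        rw [← h10, add_zero, Function.update_eq_self, Function.update_eq_self_iff]
        exact h10
      rw [this]
      linarith [show (0 : ℝ) ≤ 1 / (4 * β) by positivity]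
  · -- `r₀ = 0`: `r* = r ∘ swap 0 1`
    have : Function.update (Function.update r 0 (r 0 + r 1)) 1 0 = r ∘ Equiv.swap 0 1 := by
      funext i
      rw [← h00, zero_add]
      by_cases hi1 : i = 1
      · subst hi1; simp [← h00]
      · rw [Function.update_of_ne hi1]
        by_cases hi0 : i = 0
        · subst hi0; simp
        · rw [Function.update_of_ne hi0, Function.comp_apply, Equiv.swap_apply_of_ne_of_ne hi0 hi1]
    rw [this, twoPointPlusFourier_comp_perm]
    linarith [show (0 : ℝ) ≤ 1 / (4 * β) by positivity]

end Monotone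

end Literature.Probability.LatticeModels

end
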